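import Summits.QuantumFields.YangMills.Theorems.ColdStartUniversalityLatticeLangevinCocycleLegs
import HarnessLib

/-!
# Route `ColdStartUniversality` (rung input (M), crux K_A1 stmt-QuantumFields-24809): the solution identity of the
# flow read through dyadic Riemann–Itô sums, jointly measurably in the start

Helper file (seat `ym-line-csu-p1`, g4), for the splicing proof of the flow (cocycle) property.  For the regular flow `U`
on the canonical space, a start `y`, a matrix entry `(e, i, j)` and a real part/imaginary part functional `c`:

* `tendsto_measure_riemannIdentity` — the sums over the noise index `n` of the dyadic Riemann–Itô sums of
  `c(σ_{e,n}(ρ ∘ U y)ᵢⱼ)` against the coordinate `W^{e,n}` converge IN PROBABILITY, at each time `r`, to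
  `c(ρ(U y r)ᵢⱼ − ρ(y)ᵢⱼ − ∫₀ʳ b_e(ρ ∘ U y)ᵢⱼ)` (u.c.p. convergence to the Itô integrals + the solution identity);
* `measurable_riemannIdentity_param` — the difference «Riemann sums − identity» is jointly measurable in `(y, q)`,
  so that it can be frozen at a random `𝓕_s`-measurable start against the shifted path
  (`tendsto_measure_comp_shift_of_forall`).

No definition, no sorry.  RECORD-rung R3 plumbing; nothing here bears on the mass gap.
-/

set_option autoImplicit false

noncomputable section

namespace Summit.QuantumFields.YangMills.Theorems.ColdStartUniversality

open MeasureTheory ProbabilityTheory Filter Topology Finset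
open scoped NNReal ENNReal BigOperators
open Literature Literature.Probability.Process Literature.MathematicalPhysics.QuantumFieldTheory
open Literature.MathematicalPhysics.QuantumLattice (fundamentalRep fundamentalLatticeRep continuous_fundamentalRep)

variable {Ω : Type} [MeasurableSpace Ω] {P : Measure Ω} [IsProbabilityMeasure P] {L : ℕ} [NeZero L]
  {W : ℝ≥0 → Ω → (Edge 3 L × NoiseIdx 2 → ℝ)}

/-- **The solution identity through Riemann–Itô sums, in probability** (fixed deterministic start). [folklore] -/
theorem tendsto_measure_riemannIdentity (hW : IsFlatBrownian W P) (β : ℝ)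
    (U : GaugeConfig 3 L (Matrix.specialUnitaryGroup (Fin 2) ℂ) → ℝ≥0 →
      {p : ℝ≥0 → (Edge 3 L × NoiseIdx 2 → ℝ) // Continuous p ∧ p 0 = 0} →
      GaugeConfig 3 L (Matrix.specialUnitaryGroup (Fin 2) ℂ))
    (hU0 : ∀ y p, U y 0 p = y)
    (hprog : ∀ i : ℝ≥0, Measurable[@Prod.instMeasurableSpace (Set.Iic i)
        (GaugeConfig 3 L (Matrix.specialUnitaryGroup (Fin 2) ℂ) ×
          {p : ℝ≥0 → (Edge 3 L × NoiseIdx 2 → ℝ) // Continuous p ∧ p 0 = 0}) inferInstance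
        (@Prod.instMeasurableSpace (GaugeConfig 3 L (Matrix.specialUnitaryGroup (Fin 2) ℂ))
          {p : ℝ≥0 → (Edge 3 L × NoiseIdx 2 → ℝ) // Continuous p ∧ p 0 = 0} inferInstance
          ((isFlatBrownian_canonical hW).natFiltration i))]
      (fun q : Set.Iic i × (GaugeConfig 3 L (Matrix.specialUnitaryGroup (Fin 2) ℂ) ×
        {p : ℝ≥0 → (Edge 3 L × NoiseIdx 2 → ℝ) // Continuous p ∧ p 0 = 0}) => U q.2.1 q.1 q.2.2))
    {G : Set (GaugeConfig 3 L (Matrix.specialUnitaryGroup (Fin 2) ℂ) ×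
      {p : ℝ≥0 → (Edge 3 L × NoiseIdx 2 → ℝ) // Continuous p ∧ p 0 = 0})}
    (hGc : ∀ q ∈ G, Continuous fun r => U q.1 r q.2)
    (hGae : ∀ y, ∀ᵐ q ∂(P.map (fun ω => (⟨fun t => W t ω, continuous_path_and_zero hW ω⟩ :
        {p : ℝ≥0 → (Edge 3 L × NoiseIdx 2 → ℝ) // Continuous p ∧ p 0 = 0}))), (y, q) ∈ G)
    (hsol : ∀ y, (latticeLangevinDynamics (fundamentalLatticeRep 2) β).IsSolution (fundamentalRep (Fin 2))
      (isFlatBrownian_canonical hW).natFiltration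
      (P.map (fun ω => (⟨fun t => W t ω, continuous_path_and_zero hW ω⟩ :
        {p : ℝ≥0 → (Edge 3 L × NoiseIdx 2 → ℝ) // Continuous p ∧ p 0 = 0})))
      (fun (t : ℝ≥0) (p : {p : ℝ≥0 → (Edge 3 L × NoiseIdx 2 → ℝ) // Continuous p ∧ p 0 = 0}) => p.1 t) (U y))
    (e : Edge 3 L) (i j : Fin 2) (c : ℂ →L[ℝ] ℝ)
    (hc : ∀ (n : NoiseIdx 2) {H Z : ℝ≥0 → {p : ℝ≥0 → (Edge 3 L × NoiseIdx 2 → ℝ) // Continuous p ∧ p 0 = 0} → ℂ},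
      IsItoIntegralC H (fun u (p : {p : ℝ≥0 → (Edge 3 L × NoiseIdx 2 → ℝ) // Continuous p ∧ p 0 = 0}) => p.1 u (e, n))
        Z (isFlatBrownian_canonical hW).natFiltration
        (P.map (fun ω => (⟨fun t => W t ω, continuous_path_and_zero hW ω⟩ :
          {p : ℝ≥0 → (Edge 3 L × NoiseIdx 2 → ℝ) // Continuous p ∧ p 0 = 0}))) →
      IsItoIntegral (fun u p => c (H u p)) (fun u (p : {p : ℝ≥0 → (Edge 3 L × NoiseIdx 2 → ℝ) //
        Continuous p ∧ p 0 = 0}) => p.1 u (e, n)) (fun u p => c (Z u p)) (isFlatBrownian_canonical hW).natFiltration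
        (P.map (fun ω => (⟨fun t => W t ω, continuous_path_and_zero hW ω⟩ :
          {p : ℝ≥0 → (Edge 3 L × NoiseIdx 2 → ℝ) // Continuous p ∧ p 0 = 0}))))
    (hA : ∀ (y : GaugeConfig 3 L (Matrix.specialUnitaryGroup (Fin 2) ℂ)) (n : NoiseIdx 2),
      Adapted (isFlatBrownian_canonical hW).natFiltration (fun u q =>
        c ((latticeLangevinDynamics (fundamentalLatticeRep 2) β).noise (matrixConfig (fundamentalRep (Fin 2)) (U y u q)) e n i j)))
    (y : GaugeConfig 3 L (Matrix.specialUnitaryGroup (Fin 2) ℂ)) (r : ℝ≥0) :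
    ∀ ε : ℝ, 0 < ε → Tendsto (fun m => (P.map (fun ω => (⟨fun t => W t ω, continuous_path_and_zero hW ω⟩ :
        {p : ℝ≥0 → (Edge 3 L × NoiseIdx 2 → ℝ) // Continuous p ∧ p 0 = 0})))
      {q | ε ≤ |(∑ n : NoiseIdx 2, (SimpleProcess.sample _ (hA y n) m).integral
          (fun u (p : {p : ℝ≥0 → (Edge 3 L × NoiseIdx 2 → ℝ) // Continuous p ∧ p 0 = 0}) => p.1 u (e, n)) r q) -
        c ((fundamentalRep (Fin 2) (U y r q e) : Matrix (Fin 2) (Fin 2) ℂ) i j -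
            (fundamentalRep (Fin 2) (y e) : Matrix (Fin 2) (Fin 2) ℂ) i j -
            ∫ v in (0 : ℝ)..r, (latticeLangevinDynamics (fundamentalLatticeRep 2) β).drift
              (matrixConfig (fundamentalRep (Fin 2)) (U y v.toNNReal q)) e i j)|}) atTop (𝓝 0) := by
  haveI := secondCountableTopology_su2
  haveI := borelSpace_config L
  haveI : IsProbabilityMeasure (P.map (fun ω => (⟨fun t => W t ω, continuous_path_and_zero hW ω⟩ :
      {p : ℝ≥0 → (Edge 3 L × NoiseIdx 2 → ℝ) // Continuous p ∧ p 0 = 0}))) :=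
    Measure.isProbabilityMeasure_map (measurable_pathMap hW).aemeasurable
  have hWc := isFlatBrownian_canonical hW
  obtain ⟨Jy, hJy, hid⟩ := (hsol y).exists_ito
  -- joint measurability and continuity of the integrands
  have hmU : Measurable fun q : {p : ℝ≥0 → (Edge 3 L × NoiseIdx 2 → ℝ) // Continuous p ∧ p 0 = 0} × ℝ =>
      U y q.2.toNNReal q.1 :=
    (measurable_uncurry_flow_param hW U hprog).comp ((measurable_const.prodMk measurable_fst).prodMk measurable_snd)
  have hcU : ∀ᵐ q ∂(P.map (fun ω => (⟨fun t => W t ω, continuous_path_and_zero hW ω⟩ :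
      {p : ℝ≥0 → (Edge 3 L × NoiseIdx 2 → ℝ) // Continuous p ∧ p 0 = 0}))), Continuous fun u => U y u q := by
    filter_upwards [hGae y] with q hq
    exact hGc _ hq
  -- each noise index: u.c.p. convergence of the Riemann–Itô sums to `c (Jy n)`
  have hn : ∀ (n : NoiseIdx 2) (ε : ℝ), 0 < ε → Tendsto (fun m => (P.map (fun ω => (⟨fun t => W t ω,
      continuous_path_and_zero hW ω⟩ : {p : ℝ≥0 → (Edge 3 L × NoiseIdx 2 → ℝ) // Continuous p ∧ p 0 = 0})))
      {q | ε ≤ |(SimpleProcess.sample _ (hA y n) m).integral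
          (fun u (p : {p : ℝ≥0 → (Edge 3 L × NoiseIdx 2 → ℝ) // Continuous p ∧ p 0 = 0}) => p.1 u (e, n)) r q -
        c (Jy e n i j r q)|}) atTop (𝓝 0) := by
    intro n ε hε
    have hcm : Continuous fun V : GaugeConfig 3 L (Matrix.specialUnitaryGroup (Fin 2) ℂ) =>
        c ((latticeLangevinDynamics (fundamentalLatticeRep 2) β).noise (matrixConfig (fundamentalRep (Fin 2)) V) e n i j) :=
      c.continuous.comp (continuous_noise_entry β e n i j)
    have hσm : Measurable fun q : {p : ℝ≥0 → (Edge 3 L × NoiseIdx 2 → ℝ) // Continuous p ∧ p 0 = 0} × ℝ =>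
        c ((latticeLangevinDynamics (fundamentalLatticeRep 2) β).noise (matrixConfig (fundamentalRep (Fin 2))
          (U y q.2.toNNReal q.1)) e n i j) := hcm.measurable.comp hmU
    have hσc : ∀ᵐ q ∂(P.map (fun ω => (⟨fun t => W t ω, continuous_path_and_zero hW ω⟩ :
        {p : ℝ≥0 → (Edge 3 L × NoiseIdx 2 → ℝ) // Continuous p ∧ p 0 = 0}))), Continuous fun u =>
        c ((latticeLangevinDynamics (fundamentalLatticeRep 2) β).noise (matrixConfig (fundamentalRep (Fin 2))
          (U y u q)) e n i j) := by
      filter_upwards [hcU] with q hq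
      exact hcm.comp hq
    exact tendsto_measure_of_tendstoUCP (tendstoUCP_integral_sample (hA y n) hσm hσc (hc n (hJy e n i j))) r hε
  -- sum over the noise index
  have hsum := tendsto_measure_sum (P := P.map (fun ω => (⟨fun t => W t ω, continuous_path_and_zero hW ω⟩ :
      {p : ℝ≥0 → (Edge 3 L × NoiseIdx 2 → ℝ) // Continuous p ∧ p 0 = 0}))) (Finset.univ : Finset (NoiseIdx 2))
    (a := fun n m q => (SimpleProcess.sample _ (hA y n) m).integral
      (fun u (p : {p : ℝ≥0 → (Edge 3 L × NoiseIdx 2 → ℝ) // Continuous p ∧ p 0 = 0}) => p.1 u (e, n)) r q)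
    (Z := fun n q => c (Jy e n i j r q)) (fun n _ => hn n)
  -- the solution identity identifies the limit
  have hae : ∀ᵐ q ∂(P.map (fun ω => (⟨fun t => W t ω, continuous_path_and_zero hW ω⟩ :
      {p : ℝ≥0 → (Edge 3 L × NoiseIdx 2 → ℝ) // Continuous p ∧ p 0 = 0}))),
      (∑ n : NoiseIdx 2, c (Jy e n i j r q)) =
        c ((fundamentalRep (Fin 2) (U y r q e) : Matrix (Fin 2) (Fin 2) ℂ) i j -
            (fundamentalRep (Fin 2) (y e) : Matrix (Fin 2) (Fin 2) ℂ) i j -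
            ∫ v in (0 : ℝ)..r, (latticeLangevinDynamics (fundamentalLatticeRep 2) β).drift
              (matrixConfig (fundamentalRep (Fin 2)) (U y v.toNNReal q)) e i j) := by
    filter_upwards [hid] with q hq
    have h := hq r e i j
    rw [hU0] at h
    rw [← map_sum]
    congr 1
    have h2 := eq_sub_of_add_eq ((add_comm _ _).trans h.symm)
    rw [sub_sub]
    exact h2
  exact tendsto_measure_of_ae_eq hsum hae

/-- **Joint measurability in (start, path) of «Riemann–Itô sums − identity»** (explicit finite sums of measurable
observables of the progressively measurable flow; the time integral by Fubini measurability). [folklore] -/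
theorem measurable_riemannIdentity_param (hW : IsFlatBrownian W P) (β : ℝ)
    (U : GaugeConfig 3 L (Matrix.specialUnitaryGroup (Fin 2) ℂ) → ℝ≥0 →
      {p : ℝ≥0 → (Edge 3 L × NoiseIdx 2 → ℝ) // Continuous p ∧ p 0 = 0} →
      GaugeConfig 3 L (Matrix.specialUnitaryGroup (Fin 2) ℂ))
    (hprog : ∀ i : ℝ≥0, Measurable[@Prod.instMeasurableSpace (Set.Iic i)
        (GaugeConfig 3 L (Matrix.specialUnitaryGroup (Fin 2) ℂ) ×
          {p : ℝ≥0 → (Edge 3 L × NoiseIdx 2 → ℝ) // Continuous p ∧ p 0 = 0}) inferInstance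
        (@Prod.instMeasurableSpace (GaugeConfig 3 L (Matrix.specialUnitaryGroup (Fin 2) ℂ))
          {p : ℝ≥0 → (Edge 3 L × NoiseIdx 2 → ℝ) // Continuous p ∧ p 0 = 0} inferInstance
          ((isFlatBrownian_canonical hW).natFiltration i))]
      (fun q : Set.Iic i × (GaugeConfig 3 L (Matrix.specialUnitaryGroup (Fin 2) ℂ) ×
        {p : ℝ≥0 → (Edge 3 L × NoiseIdx 2 → ℝ) // Continuous p ∧ p 0 = 0}) => U q.2.1 q.1 q.2.2))
    (e : Edge 3 L) (i j : Fin 2) (c : ℂ →L[ℝ] ℝ)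
    (hA : ∀ (y : GaugeConfig 3 L (Matrix.specialUnitaryGroup (Fin 2) ℂ)) (n : NoiseIdx 2),
      Adapted (isFlatBrownian_canonical hW).natFiltration (fun u q =>
        c ((latticeLangevinDynamics (fundamentalLatticeRep 2) β).noise (matrixConfig (fundamentalRep (Fin 2)) (U y u q)) e n i j)))
    (m : ℕ) (r : ℝ≥0) :
    Measurable fun yq : GaugeConfig 3 L (Matrix.specialUnitaryGroup (Fin 2) ℂ) ×
        {p : ℝ≥0 → (Edge 3 L × NoiseIdx 2 → ℝ) // Continuous p ∧ p 0 = 0} =>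
      (∑ n : NoiseIdx 2, (SimpleProcess.sample _ (hA yq.1 n) m).integral
          (fun u (p : {p : ℝ≥0 → (Edge 3 L × NoiseIdx 2 → ℝ) // Continuous p ∧ p 0 = 0}) => p.1 u (e, n)) r yq.2) -
        c ((fundamentalRep (Fin 2) (U yq.1 r yq.2 e) : Matrix (Fin 2) (Fin 2) ℂ) i j -
            (fundamentalRep (Fin 2) (yq.1 e) : Matrix (Fin 2) (Fin 2) ℂ) i j -
            ∫ v in (0 : ℝ)..r, (latticeLangevinDynamics (fundamentalLatticeRep 2) β).drift
              (matrixConfig (fundamentalRep (Fin 2)) (U yq.1 v.toNNReal yq.2)) e i j) := by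
  haveI := secondCountableTopology_su2
  haveI := borelSpace_config L
  have hpair := measurable_flow_pair hW U hprog
  have hentry : ∀ (e' : Edge 3 L) (i' j' : Fin 2), Measurable fun V : GaugeConfig 3 L (Matrix.specialUnitaryGroup (Fin 2) ℂ) =>
      (fundamentalRep (Fin 2) (V e') : Matrix (Fin 2) (Fin 2) ℂ) i' j' := fun e' i' j' =>
    ((continuous_subtype_val.comp (continuous_apply e')).matrix_elem i' j').measurable
  have hcoord : ∀ (t : ℝ≥0) (n : NoiseIdx 2), Measurable fun q : {p : ℝ≥0 → (Edge 3 L × NoiseIdx 2 → ℝ) //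
      Continuous p ∧ p 0 = 0} => q.1 t (e, n) := fun t n =>
    (measurable_pi_apply (e, n)).comp ((measurable_pi_apply t).comp measurable_subtype_coe)
  refine Measurable.sub (Finset.measurable_sum _ fun n _ => ?_) (c.measurable.comp ?_)
  · -- one Riemann–Itô sum, unfolded
    have hcm : Measurable fun V : GaugeConfig 3 L (Matrix.specialUnitaryGroup (Fin 2) ℂ) =>
        c ((latticeLangevinDynamics (fundamentalLatticeRep 2) β).noise (matrixConfig (fundamentalRep (Fin 2)) V) e n i j) :=
      (c.continuous.comp (continuous_noise_entry β e n i j)).measurable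
    show Measurable fun yq : GaugeConfig 3 L (Matrix.specialUnitaryGroup (Fin 2) ℂ) ×
        {p : ℝ≥0 → (Edge 3 L × NoiseIdx 2 → ℝ) // Continuous p ∧ p 0 = 0} =>
      ∑ k ∈ Finset.range ((dyadicTimes m).length - 1),
        clamp m (c ((latticeLangevinDynamics (fundamentalLatticeRep 2) β).noise
          (matrixConfig (fundamentalRep (Fin 2)) (U yq.1 (((k : ℕ) : ℝ≥0) / 2 ^ m) yq.2)) e n i j)) *
          (yq.2.1 (min r ((dyadicTimes m).getD (k + 1) 0)) (e, n) - yq.2.1 (min r ((dyadicTimes m).getD k 0)) (e, n))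
    refine Finset.measurable_sum _ fun k _ => ?_
    exact ((continuous_clamp m).measurable.comp (hcm.comp (hpair _))).mul
      (((hcoord _ n).comp measurable_snd).sub ((hcoord _ n).comp measurable_snd))
  · -- the identity side
    have hdm : Measurable fun V : GaugeConfig 3 L (Matrix.specialUnitaryGroup (Fin 2) ℂ) =>
        (latticeLangevinDynamics (fundamentalLatticeRep 2) β).drift (matrixConfig (fundamentalRep (Fin 2)) V) e i j :=
      (continuous_drift_entry β e i j).measurable
    have hF : Measurable fun z : (GaugeConfig 3 L (Matrix.specialUnitaryGroup (Fin 2) ℂ) ×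
        {p : ℝ≥0 → (Edge 3 L × NoiseIdx 2 → ℝ) // Continuous p ∧ p 0 = 0}) × ℝ =>
        (latticeLangevinDynamics (fundamentalLatticeRep 2) β).drift
          (matrixConfig (fundamentalRep (Fin 2)) (U z.1.1 z.2.toNNReal z.1.2)) e i j :=
      hdm.comp (measurable_uncurry_flow_param hW U hprog)
    have hint : Measurable fun yq : GaugeConfig 3 L (Matrix.specialUnitaryGroup (Fin 2) ℂ) ×
        {p : ℝ≥0 → (Edge 3 L × NoiseIdx 2 → ℝ) // Continuous p ∧ p 0 = 0} =>
        ∫ v in (0 : ℝ)..r, (latticeLangevinDynamics (fundamentalLatticeRep 2) β).drift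
          (matrixConfig (fundamentalRep (Fin 2)) (U yq.1 v.toNNReal yq.2)) e i j := by
      simp_rw [intervalIntegral.integral_of_le (NNReal.coe_nonneg r)]
      exact (hF.stronglyMeasurable.integral_prod_right' (ν := volume.restrict (Set.Ioc (0 : ℝ) r))).measurable
    exact (((hentry e i j).comp (hpair r)).sub ((hentry e i j).comp measurable_fst)).sub hint

end Summit.QuantumFields.YangMills.Theorems.ColdStartUniversality

end
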